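import Literature.MathematicalPhysics.QuantumFieldTheory.Balaban1983to89.B6CovTildeMatrixV1
import Literature.MathematicalPhysics.QuantumFieldTheory.Balaban1983to89.B6CovTildeRowSumV1
import Literature.MathematicalPhysics.QuantumFieldTheory.Balaban1983to89.B6Kernel2147DecayV1

/-!
# `Balaban1983to89.B6CovTildeDecayV1` — T. Bałaban, *Propagators and renormalization transformations for lattice gauge
# theories. II*, Commun. Math. Phys. **96** (1984) 223–250 [Balaban1984PropagatorsII], p. 246 (text after (2.128)): **«… a covariance C̃^{(j)}_Λ of
# the Gaussian integral in (2.119) is bounded from above by a positive constant dependent on d and L only, and it has an exponential decay with a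
# decay rate having the same property» — THE EXPONENTIAL DECAY, FOR THE CONCRETE TWO-SCALE DATA `tsV1`**: for weights `a₀κ ≤ w ≤ a₁κ` (`κ` the V1
# normalisation) there is a rate `δ = δ(d, L, a₀, a₁) > 0` with `|⟨e_b, C̃^{(j)}_Λe_{b′}⟩| ≤ (2/γ̃)·e^{−δ|x_b − x_{b′}|_T}` for all bonds of the unit torus
# `T^{(j)}`, uniformly in the volume, in `j` and in `Λ′` — by the Combes–Thomas route

statement-level skeleton of published theorems with citation tags; proofs where landed; nothing here is a claim about the Yang–Mills mass gap

PDF held: `paper:balaban1984-cmp96-propagators-rt-ii` (journal page = PDF page + 222; p. 246 [PDF 24] read AS IMAGE on the ×2 render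
`run/shared/lean/pub/pub-balaban/b2b-balaban-ref1/pages/1984-cmp96-propagators-rt-II/…-p024-x2.png`, 2026-08-22).

PRINT (verbatim, p. 246).  *"Another consequence is a bound from below for the form (2.120), or for the form (2.122). These forms are bounded from
below by γ₀″‖B‖² with a positive constant γ₀″ dependent on d and L only. This implies that a covariance C̃^{(j)}_Λ of the Gaussian integral in
(2.119) is bounded from above by a positive constant dependent on d and L only, and it has an exponential decay with a decay rate having the same
property."*  (p. 244: *"(we take a = 1)"*.)

CITATION HEADER (lean-in-tree rule) — WHAT IS REPRODUCED.  Phase-2 file of the `lit-balaban` typed skeleton (HOME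
`run/shared/lean/pub/lit-balaban/`), seat **p22 gen 12** (B6 fold owner r03, referee ref-4; lane = the Sect. C chain (2.95)–(2.147) on the
concrete two-scale data `tsV1`).  SKELETON row **B6.Txt@246**: the «exponential decay» clause of the C̃-sentence, INSTANCED for the concrete model
(the «bounded from above» clause is gen 11's `…B6Ineq2122TwoScaleV1.inner_Ct_le_V1`).  IMPORTS BY NAME: `…B6CovTildeMatrixV1.covt_kernel_decay_of_herr`
(the decay, conditional on the Schur bound `hSe`) and `SbMatrix_isSymm`, `…B6CovTildeRowSumV1.rowSum_Q_le/rowSum_Δ_le` (row sums of the Schur majorant),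
`…B6QppKernelV1.inner_single_Sb_single/qpp_single_nonneg`, `…B6Cov2110MatrixV1.siteMatrix_apply_eq_inner`, gen 11's `…B6Cov2110WeightV1.schur_symm/
conjError_ge/abs_torusSupNorm_sub_sub_le/torusSupNorm_neg/torusSupNorm_zero`, gen 8's `…B6SectCPositivity.Δj_symm`, pv23's `Beta.CombesThomasForm.abs_exp_sub_one_le`;
for §4 `…B6Kernel2147DecayV1.kernel2147_decay_of_Ct_decay` (the transfer of a `C̃`-kernel bound to the kernel of `QGQ*` through (2.146)).
THIS FILE (parameter set written `⟨d + 1, L, m, K, _, _⟩` — every `P : Params` has this form; `D(b, b′) = |x_b − x_{b′}|_T`; `κ = c²/(η^{d+1}L^{2j})`,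
`Γ = 481(d+1)⁶L^{2(d+1)+4}`, `γ̃ = min(w₀, κ)Γ⁻¹`, `κ₁ = κ₁₆₆(d+1)/(d+1)`, `C_Δ = M_C(d+1, κ₁₆₆)·periodConst(κ₁₆₆, d)·(4/κ₁)·(d+1)·latticeConst(d+1, κ₁/4)`):
* §1 **`herr_Ct_V1`**: the conjugation-error (Schur) hypothesis `hSe` of `covt_kernel_decay_of_herr` HOLDS for the site weight `φ(b) = δ|x_b − a|_T`
  whenever `0 ≤ δ ≤ κ₁/2`, weights `0 < w ≤ w₁`, and `(e^{3Lδ} − 1)·2w₁ + δ·κ·C_Δ ≤ γ̃/2` (`γ̃` with any `w₀`);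
* §2 **`covt_kernel_decay_of_le`**: under the same conditions `|⟨e_b, C̃^{(j)}_Λe_{b′}⟩| ≤ (2/γ̃)·e^{−δD(b, b′)}`;
* §3 **`covt_kernel_decay_uniform`**: for every dimension `d + 1`, block size `L` and `0 < a₀ ≤ a₁` there is `δ > 0` such that for every volume `(m, K)`,
  every `c ≠ 0`, every level `j + 1 ≤ m + K`, every `Λ′ ⊂ T^{(j+1)}`, all weights with `a₀κ ≤ w ≤ a₁κ` and all bonds `b, b′`,
  `|⟨e_b, C̃^{(j)}_Λe_{b′}⟩| ≤ (2/(min(a₀κ, κ)Γ⁻¹))·e^{−δD(b, b′)}` — *«an exponential decay with a decay rate [dependent on d and L only]»* with the order of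
  quantifiers literal (the rate depends on `d, L` and the weight ratios `a₀, a₁` only; the prefactor carries the V1 normalisation `κ`:
  `min(a₀κ, κ) = κ·min(a₀, 1)`);
* §4 **`kernel2147_decay_uniform`** (row B6.Eq2.144, p. 248 *«Of course we have also … an exponential decay of a kernel of the operator in (2.147)»*):
  with the same data and the same `δ`, for all indices `i, i′ ∈ 𝔅 = Λ^c ⊔ Λ′`: `|⟨e_i, QGQ*e_{i′}⟩| ≤ (2/(min(a₀κ, κ)Γ⁻¹))·e^{2δ(2L−1)}·e^{−δ|p(i) − p(i′)|_T}`
  (`p(i)` the position of the index: `x_{o₋}` for a `Λ^c`-bond `o`, the anchor `x̂(c₋)` for a `Λ′`-bond `c`), by §3 and `…B6Kernel2147DecayV1`.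
THEOREMS ONLY (no definition, no `def … : Prop` fact); standard axioms.  HONEST SCOPE: an ENTRY bound in the bond basis of the finite unit torus of the
V1 calculus with the torus sup-metric of the box representatives of the source sites; the weights must be comparable to the normalisation `κ` (print:
`a = 1` at the unit normalisation); crude explicit constants (ours); `L` odd, centred blocks; the covariance is gen 7's typed `C̃^{(j)}_Λ = covOp Ax
(Q″*aQ″ + Δ_j)` of `tsV1 hc Λ′ w` (`c ≠ 0`, `j + 1 ≤ m + K`), §4 for gen 7's typed `QGQ* = Q″Q_jΔ_a⁻¹Q_j*Q″*` on `L²(𝔅)` (the whole `𝔅`; print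
restricts to `□`); NOT summit progress.  (v1 text = the infrastructure-bounced p313367 + §4.)
-/

noncomputable section

open scoped InnerProductSpace
open Finset Matrix

namespace Literature.MathematicalPhysics.QuantumFieldTheory.Balaban1983to89.B6CovTildeDecayV1

open LatticeFieldCalculus B6SectAOperatorsV1 B6SectCTwoScaleV1 B6SectCTwoScaleV1Lattice
open B6SectCOperators (TwoScaleData)
open B6SectCPositivity (Δj_symm)
open B5SectBStatements (eta)
open B4TorusKernel (periodConst)
open B4TorusKernel.MultiPeriod (torusSupNorm torusSupNorm_nonneg)
open B4Sect5Proof (latticeConst latticeConst_nonneg)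
open B5Eq117TorusCarriers (Mk)
open B6LowerBound2153Torus (rep)
open B6Cov2156Torus (one_le_M)
open B12Eq443LatticeMoments (MC)
open B5Symbol166Strip (kappa166 kappa166_pos)
open B6Cov2110MatrixV1 (siteMatrix_apply_eq_inner)
open B6Cov2110WeightV1 (torusSupNorm_neg torusSupNorm_zero abs_torusSupNorm_sub_sub_le schur_symm conjError_ge)
open B6QppKernelV1 (qpp_single_nonneg inner_single_Sb_single)
open B6CovTildeMatrixV1 (covt_kernel_decay_of_herr)
open B6CovTildeRowSumV1 (rowSum_Q_le rowSum_Δ_le)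
open Beta.CombesThomasForm (abs_exp_sub_one_le)

/-! ## §1  The conjugation-error (Schur) hypothesis `hSe` for the site weight -/

section Decay

variable {d L m K : ℕ} {hd : 1 ≤ d + 1} {hL : Odd L ∧ 1 < L} {c : ℝ} (hc : c ≠ 0) {j : ℕ}
  (Λ' : Finset (Site (⟨d + 1, L, m, K, hd, hL⟩ : Params) (j + 1))) {w : CIdx j Λ' → ℝ} (hw : ∀ i, 0 < w i)
  [DecidableEq (PBond (⟨d + 1, L, m, K, hd, hL⟩ : Params) j)]

include hw in
/-- **THE SCHUR BOUND `hSe` HOLDS FOR THE CONCRETE `Q″*aQ″ + Δ_j`**: for the site weight `φ(b) = δ|x_b − a|_T` (any base point `a`) with `0 ≤ δ ≤ κ₁/2`,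
weights `0 < w ≤ w₁` and `(e^{3Lδ} − 1)·2w₁ + δ·κ·C_Δ ≤ γ̃/2`, the Combes–Thomas conjugation error of the matrix `S̃` of `Q″*aQ″ + Δ_j` on `range P̃`
is `≥ −(γ̃/2)‖P̃u‖²` (`abs_torusSupNorm_sub_sub_le`, `abs_exp_sub_one_le`, `conjError_ge`, `schur_symm`, `rowSum_Q_le`, `rowSum_Δ_le`).
[cite: Balaban1984PropagatorsII, p.246 (text after (2.128))] -/
theorem herr_Ct_V1 (hj : j + 1 ≤ m + K) {w₀ w₁ : ℝ} (hw₁ : 0 ≤ w₁) (hw1 : ∀ i, w i ≤ w₁)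
    {δ : ℝ} (hδ0 : 0 ≤ δ) (hδ : δ ≤ kappa166 (d + 1) / ((d : ℝ) + 1) / 2)
    (hR : (Real.exp (3 * L * δ) - 1) * (2 * w₁) +
        δ * (c ^ 2 / (eta L j ^ (d + 1) * ((L : ℝ) ^ j) ^ 2) * (MC (d + 1) (kappa166 (d + 1)) * periodConst (kappa166 (d + 1)) d) *
            (4 / (kappa166 (d + 1) / ((d : ℝ) + 1)))) *
          (((d : ℝ) + 1) * latticeConst (d + 1) (kappa166 (d + 1) / ((d : ℝ) + 1) / 4)) ≤
      min w₀ (c ^ 2 / (eta L j ^ (d + 1) * ((L : ℝ) ^ j) ^ 2)) * (481 * ((d + 1 : ℕ) : ℝ) ^ 6 * (L : ℝ) ^ (2 * (d + 1) + 4))⁻¹ / 2)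
    (a : Fin (d + 1) → ℤ) (u : PBond (⟨d + 1, L, m, K, hd, hL⟩ : Params) j → ℝ) :
    -(min w₀ (c ^ 2 / (eta L j ^ (d + 1) * ((L : ℝ) ^ j) ^ 2)) * (481 * ((d + 1 : ℕ) : ℝ) ^ 6 * (L : ℝ) ^ (2 * (d + 1) + 4))⁻¹ / 2) *
        (Matrix.of (fun x x' : PBond (⟨d + 1, L, m, K, hd, hL⟩ : Params) j =>
              (axial ⟨d + 1, L, m, K, hd, hL⟩ j Λ').starProjection (EuclideanSpace.single x' (1 : ℝ)) x) *ᵥ u ⬝ᵥ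
          Matrix.of (fun x x' : PBond (⟨d + 1, L, m, K, hd, hL⟩ : Params) j =>
              (axial ⟨d + 1, L, m, K, hd, hL⟩ j Λ').starProjection (EuclideanSpace.single x' (1 : ℝ)) x) *ᵥ u) ≤
      ∑ b, ∑ b', (Real.exp (δ * torusSupNorm (Mk ⟨d + 1, L, m, K, hd, hL⟩ j) (rep (Mk ⟨d + 1, L, m, K, hd, hL⟩ j) b.src - a) -
            δ * torusSupNorm (Mk ⟨d + 1, L, m, K, hd, hL⟩ j) (rep (Mk ⟨d + 1, L, m, K, hd, hL⟩ j) b'.src - a)) - 1) *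
          Matrix.of (fun x x' : PBond (⟨d + 1, L, m, K, hd, hL⟩ : Params) j => (tsV1 hc Λ' w).Sb (EuclideanSpace.single x' (1 : ℝ)) x) b b' *
        ((Matrix.of (fun x x' : PBond (⟨d + 1, L, m, K, hd, hL⟩ : Params) j =>
              (axial ⟨d + 1, L, m, K, hd, hL⟩ j Λ').starProjection (EuclideanSpace.single x' (1 : ℝ)) x) *ᵥ u) b *
          (Matrix.of (fun x x' : PBond (⟨d + 1, L, m, K, hd, hL⟩ : Params) j =>
              (axial ⟨d + 1, L, m, K, hd, hL⟩ j Λ').starProjection (EuclideanSpace.single x' (1 : ℝ)) x) *ᵥ u) b') := by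
  set M := Mk (⟨d + 1, L, m, K, hd, hL⟩ : Params) j with hM
  -- opaque abbreviations (no `set`: abstracting matrix-valued terms over the goal is expensive)
  obtain ⟨S, hS⟩ : ∃ S : Matrix (PBond (⟨d + 1, L, m, K, hd, hL⟩ : Params) j) (PBond (⟨d + 1, L, m, K, hd, hL⟩ : Params) j) ℝ,
      S = Matrix.of (fun x x' : PBond (⟨d + 1, L, m, K, hd, hL⟩ : Params) j => (tsV1 hc Λ' w).Sb (EuclideanSpace.single x' (1 : ℝ)) x) := ⟨_, rfl⟩
  obtain ⟨v, hv⟩ : ∃ v : PBond (⟨d + 1, L, m, K, hd, hL⟩ : Params) j → ℝ,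
      v = Matrix.of (fun x x' : PBond (⟨d + 1, L, m, K, hd, hL⟩ : Params) j =>
      (axial ⟨d + 1, L, m, K, hd, hL⟩ j Λ').starProjection (EuclideanSpace.single x' (1 : ℝ)) x) *ᵥ u := ⟨_, rfl⟩
  obtain ⟨k, hk⟩ : ∃ k : PBond (⟨d + 1, L, m, K, hd, hL⟩ : Params) j → PBond (⟨d + 1, L, m, K, hd, hL⟩ : Params) j → ℝ, k = fun b b' =>
      (Real.exp (δ * torusSupNorm M (rep M b.src - rep M b'.src)) - 1) *
        (∑ i : CIdx j Λ', w i * (Qpp ⟨d + 1, L, m, K, hd, hL⟩ j Λ' (EuclideanSpace.single b (1 : ℝ)) i *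
            Qpp ⟨d + 1, L, m, K, hd, hL⟩ j Λ' (EuclideanSpace.single b' (1 : ℝ)) i) +
          |⟪EuclideanSpace.single b (1 : ℝ), (tsV1 hc Λ' w).Δj (EuclideanSpace.single b' (1 : ℝ))⟫_ℝ|) := ⟨_, rfl⟩
  have hQ0 : ∀ b b' : PBond (⟨d + 1, L, m, K, hd, hL⟩ : Params) j,
      0 ≤ ∑ i : CIdx j Λ', w i * (Qpp ⟨d + 1, L, m, K, hd, hL⟩ j Λ' (EuclideanSpace.single b (1 : ℝ)) i *
        Qpp ⟨d + 1, L, m, K, hd, hL⟩ j Λ' (EuclideanSpace.single b' (1 : ℝ)) i) := fun b b' =>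
    Finset.sum_nonneg fun i _ => mul_nonneg (hw i).le (mul_nonneg (qpp_single_nonneg Λ' b i) (qpp_single_nonneg Λ' b' i))
  have hE0 : ∀ b b' : PBond (⟨d + 1, L, m, K, hd, hL⟩ : Params) j, 0 ≤ Real.exp (δ * torusSupNorm M (rep M b.src - rep M b'.src)) - 1 := by
    intro b b'
    have h0 : 0 ≤ δ * torusSupNorm M (rep M b.src - rep M b'.src) := mul_nonneg hδ0 (torusSupNorm_nonneg (one_le_M M) _)
    linarith [Real.add_one_le_exp (δ * torusSupNorm M (rep M b.src - rep M b'.src))]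
  -- `|S̃(b, b′)| ≤ Σ_i w_i q_i(b)q_i(b′) + |⟨e_b, Δ_je_{b′}⟩|`
  have hSabs : ∀ b b' : PBond (⟨d + 1, L, m, K, hd, hL⟩ : Params) j, |S b b'| ≤
      ∑ i : CIdx j Λ', w i * (Qpp ⟨d + 1, L, m, K, hd, hL⟩ j Λ' (EuclideanSpace.single b (1 : ℝ)) i *
          Qpp ⟨d + 1, L, m, K, hd, hL⟩ j Λ' (EuclideanSpace.single b' (1 : ℝ)) i) +
        |⟪EuclideanSpace.single b (1 : ℝ), (tsV1 hc Λ' w).Δj (EuclideanSpace.single b' (1 : ℝ))⟫_ℝ| := by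
    intro b b'
    rw [hS, siteMatrix_apply_eq_inner, inner_single_Sb_single]
    exact (abs_add_le _ _).trans (by rw [abs_of_nonneg (hQ0 b b')])
  have hbound : ∀ b b' : PBond (⟨d + 1, L, m, K, hd, hL⟩ : Params) j,
      |Real.exp (δ * torusSupNorm M (rep M b.src - a) - δ * torusSupNorm M (rep M b'.src - a)) - 1| * |S b b'| ≤ k b b' := by
    intro b b'
    have hφ : |δ * torusSupNorm M (rep M b.src - a) - δ * torusSupNorm M (rep M b'.src - a)| ≤
        δ * torusSupNorm M (rep M b.src - rep M b'.src) := by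
      rw [← mul_sub, abs_mul, abs_of_nonneg hδ0]
      exact mul_le_mul_of_nonneg_left (abs_torusSupNorm_sub_sub_le M _ _ _) hδ0
    rw [hk]
    exact mul_le_mul (abs_exp_sub_one_le hφ) (hSabs b b') (abs_nonneg _) (hE0 b b')
  have h1 := conjError_ge S (fun b => δ * torusSupNorm M (rep M b.src - a)) k hbound v
  -- symmetry of the majorant
  have hQs : ∀ b b' : PBond (⟨d + 1, L, m, K, hd, hL⟩ : Params) j,
      ∑ i : CIdx j Λ', w i * (Qpp ⟨d + 1, L, m, K, hd, hL⟩ j Λ' (EuclideanSpace.single b (1 : ℝ)) i *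
          Qpp ⟨d + 1, L, m, K, hd, hL⟩ j Λ' (EuclideanSpace.single b' (1 : ℝ)) i) =
        ∑ i : CIdx j Λ', w i * (Qpp ⟨d + 1, L, m, K, hd, hL⟩ j Λ' (EuclideanSpace.single b' (1 : ℝ)) i *
          Qpp ⟨d + 1, L, m, K, hd, hL⟩ j Λ' (EuclideanSpace.single b (1 : ℝ)) i) :=
    fun b b' => Finset.sum_congr rfl fun i _ => by ring
  have hKs : ∀ b b' : PBond (⟨d + 1, L, m, K, hd, hL⟩ : Params) j,
      |⟪EuclideanSpace.single b (1 : ℝ), (tsV1 hc Λ' w).Δj (EuclideanSpace.single b' (1 : ℝ))⟫_ℝ| =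
        |⟪EuclideanSpace.single b' (1 : ℝ), (tsV1 hc Λ' w).Δj (EuclideanSpace.single b (1 : ℝ))⟫_ℝ| := by
    intro b b'
    rw [← real_inner_comm (EuclideanSpace.single b' (1 : ℝ)) ((tsV1 hc Λ' w).Δj (EuclideanSpace.single b (1 : ℝ))),
      Δj_symm (isLattice Λ' hc hj hw)]
  have hsymm : ∀ b b' : PBond (⟨d + 1, L, m, K, hd, hL⟩ : Params) j, k b b' = k b' b := by
    intro b b'
    rw [hk]
    dsimp only
    rw [← neg_sub (rep M b'.src) (rep M b.src), torusSupNorm_neg, hQs b b', hKs b b']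
  have hk0 : ∀ b b' : PBond (⟨d + 1, L, m, K, hd, hL⟩ : Params) j, 0 ≤ k b b' := fun b b' => by
    rw [hk]
    exact mul_nonneg (hE0 b b') (add_nonneg (hQ0 b b') (abs_nonneg _))
  have hrow : ∀ b : PBond (⟨d + 1, L, m, K, hd, hL⟩ : Params) j, ∑ b', k b b' ≤ (Real.exp (3 * L * δ) - 1) * (2 * w₁) +
      δ * (c ^ 2 / (eta L j ^ (d + 1) * ((L : ℝ) ^ j) ^ 2) * (MC (d + 1) (kappa166 (d + 1)) * periodConst (kappa166 (d + 1)) d) *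
          (4 / (kappa166 (d + 1) / ((d : ℝ) + 1)))) *
        (((d : ℝ) + 1) * latticeConst (d + 1) (kappa166 (d + 1) / ((d : ℝ) + 1) / 4)) := by
    intro b
    have hQ := rowSum_Q_le (hd := hd) (hL := hL) Λ' hw hj hw₁ hw1 hδ0 b
    have hΔ := rowSum_Δ_le hc Λ' hw hj hδ0 hδ b
    rw [hk]
    simp only [mul_add, Finset.sum_add_distrib]
    exact add_le_add hQ hΔ
  have h2 := schur_symm k hsymm hk0 hrow v
  have h4 : v ⬝ᵥ v = ∑ x, v x ^ 2 := by simp only [dotProduct, sq]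
  have h5 : 0 ≤ ∑ x, v x ^ 2 := Finset.sum_nonneg fun x _ => sq_nonneg _
  subst hS
  rw [← hv, h4]
  refine le_trans ?_ h1
  nlinarith [mul_le_mul_of_nonneg_right hR h5, h2]

/-! ## §2  The decay of the kernel of `C̃^{(j)}_Λ` for every admissible rate -/

include hw in
/-- **EXPONENTIAL DECAY OF THE KERNEL OF `C̃^{(j)}_Λ`, ANY ADMISSIBLE RATE**: for weights `0 < w₀ ≤ w ≤ w₁` and `0 ≤ δ ≤ κ₁/2` with
`(e^{3Lδ} − 1)·2w₁ + δ·κ·C_Δ ≤ γ̃/2`, `|⟨e_b, C̃^{(j)}_Λe_{b′}⟩| ≤ (2/γ̃)·e^{−δ|x_b − x_{b′}|_T}` (`covt_kernel_decay_of_herr` with `herr_Ct_V1` at the base point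
`a = x_{b′}`). [cite: Balaban1984PropagatorsII, p.246 (text after (2.128))] -/
theorem covt_kernel_decay_of_le (hj : j + 1 ≤ m + K) {w₀ w₁ : ℝ} (hw₀ : 0 < w₀) (hw0 : ∀ i, w₀ ≤ w i) (hw₁ : 0 ≤ w₁) (hw1 : ∀ i, w i ≤ w₁)
    {δ : ℝ} (hδ0 : 0 ≤ δ) (hδ : δ ≤ kappa166 (d + 1) / ((d : ℝ) + 1) / 2)
    (hR : (Real.exp (3 * L * δ) - 1) * (2 * w₁) +
        δ * (c ^ 2 / (eta L j ^ (d + 1) * ((L : ℝ) ^ j) ^ 2) * (MC (d + 1) (kappa166 (d + 1)) * periodConst (kappa166 (d + 1)) d) *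
            (4 / (kappa166 (d + 1) / ((d : ℝ) + 1)))) *
          (((d : ℝ) + 1) * latticeConst (d + 1) (kappa166 (d + 1) / ((d : ℝ) + 1) / 4)) ≤
      min w₀ (c ^ 2 / (eta L j ^ (d + 1) * ((L : ℝ) ^ j) ^ 2)) * (481 * ((d + 1 : ℕ) : ℝ) ^ 6 * (L : ℝ) ^ (2 * (d + 1) + 4))⁻¹ / 2)
    (b b' : PBond (⟨d + 1, L, m, K, hd, hL⟩ : Params) j) :
    |⟪EuclideanSpace.single b (1 : ℝ), (tsV1 hc Λ' w).Ct (EuclideanSpace.single b' (1 : ℝ))⟫_ℝ| ≤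
      2 / (min w₀ (c ^ 2 / (eta L j ^ (d + 1) * ((L : ℝ) ^ j) ^ 2)) * (481 * ((d + 1 : ℕ) : ℝ) ^ 6 * (L : ℝ) ^ (2 * (d + 1) + 4))⁻¹) *
        Real.exp (-(δ * torusSupNorm (Mk ⟨d + 1, L, m, K, hd, hL⟩ j) (rep (Mk ⟨d + 1, L, m, K, hd, hL⟩ j) b.src -
          rep (Mk ⟨d + 1, L, m, K, hd, hL⟩ j) b'.src))) := by
  have h := covt_kernel_decay_of_herr hc hj Λ' hw hw₀ hw0
    (fun x => δ * torusSupNorm (Mk ⟨d + 1, L, m, K, hd, hL⟩ j) (rep (Mk ⟨d + 1, L, m, K, hd, hL⟩ j) x.src - rep (Mk ⟨d + 1, L, m, K, hd, hL⟩ j) b'.src))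
    (fun u => herr_Ct_V1 hc Λ' hw hj hw₁ hw1 hδ0 hδ hR _ u) b b'
  simp only [sub_self, torusSupNorm_zero, mul_zero, sub_zero] at h
  exact h

end Decay

/-! ## §3  «… an exponential decay with a decay rate [dependent on d and L only]» — the order of quantifiers -/

section Uniform

/-- elementary: `e^t − 1 ≤ t·e^T` for `0 ≤ t ≤ T`. [folklore] -/
private theorem exp_sub_one_le {t T : ℝ} (ht : 0 ≤ t) (hT : t ≤ T) : Real.exp t - 1 ≤ t * Real.exp T := by
  have h2 : 1 - t ≤ Real.exp (-t) := by linarith [Real.add_one_le_exp (-t)]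
  have h3 : Real.exp t * Real.exp (-t) = 1 := by rw [← Real.exp_add, add_neg_cancel, Real.exp_zero]
  have h4 : Real.exp t - 1 ≤ t * Real.exp t := by
    nlinarith [Real.exp_pos t, mul_le_mul_of_nonneg_left h2 (Real.exp_pos t).le]
  exact h4.trans (mul_le_mul_of_nonneg_left (Real.exp_le_exp.2 hT) ht)

open Classical in
/-- **«… A COVARIANCE C̃^{(j)}_Λ … HAS AN EXPONENTIAL DECAY WITH A DECAY RATE [DEPENDENT ON d AND L ONLY]», FOR THE CONCRETE TWO-SCALE DATA**, with the
order of quantifiers literal: for every dimension `d + 1`, block size `L` and weight ratios `0 < a₀ ≤ a₁` there is `δ > 0` such that for every volume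
`(m, K)`, every `c ≠ 0`, every level `j + 1 ≤ m + K`, every `Λ′ ⊂ T^{(j+1)}`, all weights with `a₀κ ≤ w ≤ a₁κ` (`κ = c²/(η^{d+1}L^{2j})` the V1
normalisation; print: `a = 1`) and all bonds `b, b′` of `T^{(j)}`, `|⟨e_b, C̃^{(j)}_Λe_{b′}⟩| ≤ (2/(min(a₀κ, κ)Γ⁻¹))·e^{−δ|x_b − x_{b′}|_T}`, `Γ = 481(d+1)⁶L^{2(d+1)+4}`.
[cite: Balaban1984PropagatorsII, p.246 (text after (2.128))] -/
theorem covt_kernel_decay_uniform (d L : ℕ) (hd : 1 ≤ d + 1) (hL : Odd L ∧ 1 < L) {a₀ a₁ : ℝ} (ha₀ : 0 < a₀) (ha₁ : a₀ ≤ a₁) :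
    ∃ δ : ℝ, 0 < δ ∧ ∀ (m K : ℕ) (c : ℝ) (hc : c ≠ 0) (j : ℕ) (_hj : j + 1 ≤ m + K)
      (Λ' : Finset (Site (⟨d + 1, L, m, K, hd, hL⟩ : Params) (j + 1))) (w : CIdx j Λ' → ℝ)
      (_hw0 : ∀ i, a₀ * (c ^ 2 / (eta L j ^ (d + 1) * ((L : ℝ) ^ j) ^ 2)) ≤ w i)
      (_hw1 : ∀ i, w i ≤ a₁ * (c ^ 2 / (eta L j ^ (d + 1) * ((L : ℝ) ^ j) ^ 2)))
      (b b' : PBond (⟨d + 1, L, m, K, hd, hL⟩ : Params) j),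
      |⟪EuclideanSpace.single b (1 : ℝ), (tsV1 hc Λ' w).Ct (EuclideanSpace.single b' (1 : ℝ))⟫_ℝ| ≤
        2 / (min (a₀ * (c ^ 2 / (eta L j ^ (d + 1) * ((L : ℝ) ^ j) ^ 2))) (c ^ 2 / (eta L j ^ (d + 1) * ((L : ℝ) ^ j) ^ 2)) *
            (481 * ((d + 1 : ℕ) : ℝ) ^ 6 * (L : ℝ) ^ (2 * (d + 1) + 4))⁻¹) *
          Real.exp (-(δ * torusSupNorm (Mk ⟨d + 1, L, m, K, hd, hL⟩ j) (rep (Mk ⟨d + 1, L, m, K, hd, hL⟩ j) b.src -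
            rep (Mk ⟨d + 1, L, m, K, hd, hL⟩ j) b'.src))) := by
  -- the constants: `κ₁` (rate of the `Δ_j` kernel), `CΔ` (its row-sum constant without `κ`), `Γ⁻¹`, `X`
  set κ₁ := kappa166 (d + 1) / ((d : ℝ) + 1) with hκ₁
  set CΔ := MC (d + 1) (kappa166 (d + 1)) * periodConst (kappa166 (d + 1)) d * (4 / κ₁) *
    (((d : ℝ) + 1) * latticeConst (d + 1) (κ₁ / 4)) with hCΔ
  set Γi := (481 * ((d + 1 : ℕ) : ℝ) ^ 6 * (L : ℝ) ^ (2 * (d + 1) + 4))⁻¹ with hΓi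
  set X := 6 * L * Real.exp (3 * L) * a₁ + CΔ with hX
  have hκ₁0 : 0 < κ₁ := div_pos (kappa166_pos _) (by positivity)
  have hL0 : 0 < L := by have := hL.2; omega
  have hLp : (0 : ℝ) < L := by exact_mod_cast hL0
  have hΓ : 0 < Γi := by positivity
  have ha1 : 0 < a₁ := ha₀.trans_le ha₁
  -- `CΔ ≥ 0`: read off the row-sum bound at `δ = 0`? — directly: `periodConst > 0`, `MC ≥ 0` via the kernel bound is not available here, so we argue
  -- through `X + |X|` instead: the rate below only needs `X' := max X 0`.
  set X' := max X 0 with hX'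
  have hX'0 : 0 ≤ X' := le_max_right _ _
  have hXX' : X ≤ X' := le_max_left _ _
  refine ⟨min (min (κ₁ / 2) 1) (min a₀ 1 * Γi / (2 * (X' + 1))), ?_, ?_⟩
  · refine lt_min (lt_min (half_pos hκ₁0) one_pos) (div_pos (mul_pos (lt_min ha₀ one_pos) hΓ) (by positivity))
  intro m K c hc j hj Λ' w hw0 hw1 b b'
  set δ := min (min (κ₁ / 2) 1) (min a₀ 1 * Γi / (2 * (X' + 1))) with hδ
  set κ := c ^ 2 / (eta L j ^ (d + 1) * ((L : ℝ) ^ j) ^ 2) with hκ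
  have hκ0 : 0 < κ := by
    have h := B6Ineq2118TwoScaleV1.kappa_pos (P := (⟨d + 1, L, m, K, hd, hL⟩ : Params)) hc (j := j)
    exact h
  have hw : ∀ i, 0 < w i := fun i => (mul_pos ha₀ hκ0).trans_le (hw0 i)
  have hδ0 : 0 ≤ δ := le_min (le_min (half_pos hκ₁0).le zero_le_one) (div_nonneg (mul_nonneg (le_min ha₀.le zero_le_one) hΓ.le) (by positivity))
  have hδκ : δ ≤ κ₁ / 2 := (min_le_left _ _).trans (min_le_left _ _)
  have hδ1 : δ ≤ 1 := (min_le_left _ _).trans (min_le_right _ _)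
  have hδX : δ ≤ min a₀ 1 * Γi / (2 * (X' + 1)) := min_le_right _ _
  -- the row-sum condition
  have hR : (Real.exp (3 * L * δ) - 1) * (2 * (a₁ * κ)) +
      δ * (κ * (MC (d + 1) (kappa166 (d + 1)) * periodConst (kappa166 (d + 1)) d) * (4 / κ₁)) *
        (((d : ℝ) + 1) * latticeConst (d + 1) (κ₁ / 4)) ≤ min (a₀ * κ) κ * Γi / 2 := by
    have h1 : Real.exp (3 * L * δ) - 1 ≤ 3 * L * δ * Real.exp (3 * L) :=
      exp_sub_one_le (by positivity) (by nlinarith)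
    have h2 : (Real.exp (3 * L * δ) - 1) * (2 * (a₁ * κ)) ≤ 3 * L * δ * Real.exp (3 * L) * (2 * (a₁ * κ)) :=
      mul_le_mul_of_nonneg_right h1 (by positivity)
    have h3 : (Real.exp (3 * L * δ) - 1) * (2 * (a₁ * κ)) +
        δ * (κ * (MC (d + 1) (kappa166 (d + 1)) * periodConst (kappa166 (d + 1)) d) * (4 / κ₁)) *
          (((d : ℝ) + 1) * latticeConst (d + 1) (κ₁ / 4)) ≤ δ * κ * X := by
      rw [hX, hCΔ]
      nlinarith
    have h4 : δ * κ * X ≤ δ * κ * X' := mul_le_mul_of_nonneg_left hXX' (by positivity)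
    have hmin : min (a₀ * κ) κ = min a₀ 1 * κ := by rw [min_mul_of_nonneg _ _ hκ0.le, one_mul]
    have h5 : δ * κ * X' ≤ min a₀ 1 * κ * Γi / 2 := by
      have h6 : δ * X' ≤ min a₀ 1 * Γi / (2 * (X' + 1)) * X' := mul_le_mul_of_nonneg_right hδX hX'0
      have h7 : min a₀ 1 * Γi / (2 * (X' + 1)) * X' ≤ min a₀ 1 * Γi / 2 := by
        rw [div_mul_eq_mul_div, div_le_div_iff₀ (by positivity) (by norm_num)]
        have : 0 ≤ min a₀ 1 * Γi := mul_nonneg (le_min ha₀.le zero_le_one) hΓ.le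
        nlinarith
      calc δ * κ * X' = κ * (δ * X') := by ring
        _ ≤ κ * (min a₀ 1 * Γi / 2) := mul_le_mul_of_nonneg_left (h6.trans h7) hκ0.le
        _ = min a₀ 1 * κ * Γi / 2 := by ring
    rw [hmin]
    linarith
  exact covt_kernel_decay_of_le hc Λ' hw hj (mul_pos ha₀ hκ0) hw0 (mul_nonneg ha1.le hκ0.le) hw1 hδ0 hδκ hR b b'

end Uniform

/-! ## §4  «… and an exponential decay of a kernel of the operator in (2.147)» (p. 248) — the order of quantifiers -/

section Uniform2147

open Classical in
/-- **«AN EXPONENTIAL DECAY OF A KERNEL OF THE OPERATOR IN (2.147)», FOR THE CONCRETE TWO-SCALE DATA**, with the order of quantifiers literal: for every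
dimension `d + 1`, block size `L` and weight ratios `0 < a₀ ≤ a₁` there is `δ > 0` such that for every volume `(m, K)`, every `c ≠ 0`, every level
`j + 1 ≤ m + K`, every `Λ′ ⊂ T^{(j+1)}`, all weights with `a₀κ ≤ w ≤ a₁κ` and all indices `i, i′ ∈ 𝔅 = Λ^c ⊔ Λ′`,
`|⟨e_i, QGQ*e_{i′}⟩| ≤ (2/(min(a₀κ, κ)Γ⁻¹))·e^{2δ(2L−1)}·e^{−δ|p(i) − p(i′)|_T}` (`κ = c²/(η^{d+1}L^{2j})`, `Γ = 481(d+1)⁶L^{2(d+1)+4}`; since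
`min(a₀κ, κ) = κ·min(a₀, 1)` the prefactor is `κ⁻¹` — the V1 normalisation of `C̃` — times a constant depending on `d`, `L`, `a₀` only).
[cite: Balaban1984PropagatorsII, p.248 (text after (2.147))] -/
theorem kernel2147_decay_uniform (d L : ℕ) (hd : 1 ≤ d + 1) (hL : Odd L ∧ 1 < L) {a₀ a₁ : ℝ} (ha₀ : 0 < a₀) (ha₁ : a₀ ≤ a₁) :
    ∃ δ : ℝ, 0 < δ ∧ ∀ (m K : ℕ) (c : ℝ) (hc : c ≠ 0) (j : ℕ) (_hj : j + 1 ≤ m + K)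
      (Λ' : Finset (Site (⟨d + 1, L, m, K, hd, hL⟩ : Params) (j + 1))) (w : CIdx j Λ' → ℝ)
      (_hw0 : ∀ i, a₀ * (c ^ 2 / (eta L j ^ (d + 1) * ((L : ℝ) ^ j) ^ 2)) ≤ w i)
      (_hw1 : ∀ i, w i ≤ a₁ * (c ^ 2 / (eta L j ^ (d + 1) * ((L : ℝ) ^ j) ^ 2)))
      (i i' : CIdx j Λ'),
      |⟪EuclideanSpace.single i (1 : ℝ),
          (tsV1 hc Λ' w).Q ((tsV1 hc Λ' w).G (LinearMap.adjoint (tsV1 hc Λ' w).Q (EuclideanSpace.single i' (1 : ℝ))))⟫_ℝ| ≤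
        2 / (min (a₀ * (c ^ 2 / (eta L j ^ (d + 1) * ((L : ℝ) ^ j) ^ 2))) (c ^ 2 / (eta L j ^ (d + 1) * ((L : ℝ) ^ j) ^ 2)) *
              (481 * ((d + 1 : ℕ) : ℝ) ^ 6 * (L : ℝ) ^ (2 * (d + 1) + 4))⁻¹) *
            Real.exp (2 * δ * (2 * (L : ℝ) - 1)) *
          Real.exp (-(δ * torusSupNorm (Mk ⟨d + 1, L, m, K, hd, hL⟩ j)
            (Sum.elim (fun o : OutBond j Λ' => rep (Mk ⟨d + 1, L, m, K, hd, hL⟩ j) o.1.src)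
                (fun e : InBond j Λ' => rep (Mk ⟨d + 1, L, m, K, hd, hL⟩ j) (Site.blockSite e.1.src (fun _ => ⟨0, Params.L_pos _⟩))) i -
              Sum.elim (fun o : OutBond j Λ' => rep (Mk ⟨d + 1, L, m, K, hd, hL⟩ j) o.1.src)
                (fun e : InBond j Λ' => rep (Mk ⟨d + 1, L, m, K, hd, hL⟩ j) (Site.blockSite e.1.src (fun _ => ⟨0, Params.L_pos _⟩))) i'))) := by
  obtain ⟨δ, hδ, H⟩ := covt_kernel_decay_uniform d L hd hL ha₀ ha₁
  refine ⟨δ, hδ, fun m K c hc j hj Λ' w hw0 hw1 i i' => ?_⟩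
  have hκ0 : 0 < c ^ 2 / (eta L j ^ (d + 1) * ((L : ℝ) ^ j) ^ 2) :=
    B6Ineq2118TwoScaleV1.kappa_pos (P := (⟨d + 1, L, m, K, hd, hL⟩ : Params)) hc (j := j)
  have hw : ∀ k, 0 < w k := fun k => (mul_pos ha₀ hκ0).trans_le (hw0 k)
  have hA : 0 ≤ 2 / (min (a₀ * (c ^ 2 / (eta L j ^ (d + 1) * ((L : ℝ) ^ j) ^ 2))) (c ^ 2 / (eta L j ^ (d + 1) * ((L : ℝ) ^ j) ^ 2)) *
      (481 * ((d + 1 : ℕ) : ℝ) ^ 6 * (L : ℝ) ^ (2 * (d + 1) + 4))⁻¹) := by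
    have : 0 < min (a₀ * (c ^ 2 / (eta L j ^ (d + 1) * ((L : ℝ) ^ j) ^ 2))) (c ^ 2 / (eta L j ^ (d + 1) * ((L : ℝ) ^ j) ^ 2)) :=
      lt_min (mul_pos ha₀ hκ0) hκ0
    positivity
  exact B6Kernel2147DecayV1.kernel2147_decay_of_Ct_decay hc Λ' hw hj hA hδ.le (fun b b' => H m K c hc j hj Λ' w hw0 hw1 b b') i i'

end Uniform2147

end Literature.MathematicalPhysics.QuantumFieldTheory.Balaban1983to89.B6CovTildeDecayV1

end
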